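import Literature.Barriers.ValiantsHypothesis.GCTMatrixPoweringColumns
import Literature.NumberTheory.DiophantineGeometry.KroneckerSemigroup
import Literature.Computability.Complexity.OccurrenceObstructionsIP
import Mathlib.GroupTheory.NoncommCoprod
import HarnessLib

/-!
# Gesmundo–Ikenmeyer–Panova 2017, Prop. 15 (semigroup properties of `sm`, `am`) PROVED:
# symmetric and skew Kronecker coefficients in the word model

Sibling proofs file (D-0014; theorems and model definitions only, no new named facts) of
`GCTMatrixPowering.lean` (barrier `GCTMatrixPowering = GIP2017_thm10`; `skCharSum`, `SkPos`,
`SmPos`) and `GCTMatrixPoweringColumns.lean` (`akCharSum`, `AkPos`, `AmPos`, `IsRowSum`, and the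
named fact `GIP2017_prop15`), conventions as there. After `GCTMatrixPoweringPositivity.lean` /
`GCTMatrixPoweringErratum.lean` the barrier fact rests on the four named facts `GIP2017_prop15`,
`GIP2017_prop17`, `GIP2017_prop18_corrected`, `GIP2017_prop19` of GIP §3; this file DISCHARGES the
first of them (`GIP2017_prop15_holds`).

**The printed result** (arXiv:1611.00827 = Diff. Geom. Appl. 55 (2017), §3, held text p. 9,
flat numbering; `sk(λ,μ) = dim([λ] ⊗ S²[μ])^{𝔖_D}`, `ak(λ,μ) = dim([λ] ⊗ Λ²[μ])^{𝔖_D}`,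
`sm(λ,a) := Σ_{μ : ℓ(μ) ≤ a} sk(λ,μ)`, `am(λ,a) := Σ_{μ : ℓ(μ) ≤ a} ak(λ,μ)`, `λ + ν` the row-wise
sum). "Proposition 15 (Semigroup properties). Let `λ` and `ν` be partitions. We have (1) If
`sm(λ,n) > 0` and `sm(ν,n) > 0`, then `sm(λ+ν,n) ≥ max(sm(λ,n), sm(ν,n))`. (2) If `am(λ,n) > 0` and
`am(ν,n) > 0`, then `sm(λ+ν,n) ≥ max(am(λ,n), am(ν,n))`. (3) If `sm(λ,n) > 0` and `am(ν,n) > 0`,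
then `am(λ+ν,n) ≥ max(sm(λ,n), am(ν,n))`." Printed proof (pp. 9–10): realise
`⊕_{λ,μ ⊢_n d} ℂ^{sk(λ,μ)}` as `HWV_λ(Sym^d(V ⊗ V^* ⊗ V)^H)^{𝔖₂}` (Schur–Weyl duality, `H`-invariants,
the `𝔖₂` "switching the last two tensor factors") and the skew analogue, and multiply: "If `f` and
`g` are both `𝔖₂`-invariant, then their product `fg` is `𝔖₂`-invariant. But if `f` and `g` are both
`𝔖₂`-skew-invariant, then `fg` is also `𝔖₂`-invariant. Moreover, if `f` is `𝔖₂`-invariant and `g`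
is `𝔖₂`-skew-invariant, then `fg` is `𝔖₂`-skew-invariant." The tree vendors Prop. 15 in its
POSITIVITY form (`GIP2017_prop15`: the conclusions `> 0`), which is all §3 uses and all that the
character rendering `SmPos`/`AmPos` expresses.

**The proof given here** is GIP's multiplication argument, run in the word model of the tree's
proof of the Kronecker semigroup property (`KroneckerSemigroup.lean`: `HW_χ = highestWeightSpace
(wordRep k N n) χ`, an `𝔖_n`-module with character `χ^μ` for `χ` the weight of `μ` by Schur–Weyl
duality, `character_hwPermRep`; triple tensors `M : Word3 N n → k` with partial functions in
`HW_{χ₁}, HW_{χ₂}, HW_{χ₃}`, `tripleHw`; concatenation products `concat3` and symmetrisations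
`sym3`), with the third weight equal to the second and the extra structure of the SWITCH
`s : M((w₁,w₂),w₃) ↦ M((w₁,w₃),w₂)` of the two copies of `HW_μ` (GIP's `𝔖₂`):

1. (§1) the switch on triple tensors (`swapLin`); it preserves `tripleHw χ₁ χ₂ χ₂`, commutes with
   the diagonal `𝔖_n`-action, with concatenation and with symmetrisation, so that switch-parity is
   multiplicative under the symmetrised concatenation product (`swapLin_sym3_concat3`).
2. (§2) The twisted representation of `𝔖_n × ℤˣ` on `T = HW_{χ₁} ⊗ HW_{χ₂} ⊗ HW_{χ₂}`, `-1` acting by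
   `ε s` (`ε = ±1`); its invariants are the `𝔖_n`-invariant tensors with `s M = ε M`
   (`mem_invariants_twistedRep_iff`): `([λ] ⊗ S²[μ])^{𝔖_n}` for `ε = 1`, `([λ] ⊗ Λ²[μ])^{𝔖_n}` for
   `ε = -1`.
3. (§3) Its character: `tr(σ | T) = χ₁(σ) χ₂(σ)²` and `tr(σ ∘ s | T) = χ₁(σ) χ₂(σ²)`
   (`trace_tripleHwRep`, `trace_tripleHwRep_comp_swapT`), computed in the basis of `T` transported
   from bases of `HW_{χ₁}`, `HW_{χ₂}` along the coordinate isomorphism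
   `HW_{χ₁} ⊗ (HW_{χ₂} ⊗ HW_{χ₂}) ≃ T` (`tripleEquivLin`; the diagonal entry of `σ ∘ s` at `(i,j,l)`
   is `A_{ii} B_{jl} B_{lj}`) — the linear algebra of `χ_{S²W}(σ) = (χ_W(σ)² + χ_W(σ²))/2`
   (Fulton–Harris §2.1).
4. (§4) Hence `2·n!·dim T^{𝔖_n × ℤˣ} = Σ_σ χ^λ(σ)(χ^μ(σ)² + ε χ^μ(σ²))`
   (`card_mul_finrank_invariants_twistedRep`, Fulton–Harris (2.9)), i.e. `skCharSum λ μ`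
   (`ε = 1`) and `akCharSum λ μ` (`ε = -1`) ARE `2·n!` times the dimensions of the symmetric and
   skew invariants: `SkPos λ μ` / `AkPos λ μ` iff a nonzero symmetric / skew `𝔖_n`-invariant tensor
   exists (`skPos_iff_exists`, `akPos_iff_exists`). This justifies the character rendering of
   `GCTMatrixPowering.lean` (`skCharSum = 2·D!·sk`).
5. (§5) Multiplying (`exists_twisted_invariant_mul`): the semigroup property at the level of the
   coefficients themselves — `sk(λ,μ), sk(λ',μ') > 0 ⇒ sk(λ+λ', μ+μ') > 0`; `ak, ak ⇒ sk`;
   `sk, ak ⇒ ak` (`skPos_of_isRowSum`, `skPos_of_isRowSum_of_akPos`, `akPos_of_isRowSum`), which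
   sharpens the printed statement (a sum over `μ`).
6. (§6) Prop. 15 (positivity form) for `sm`, `am` (`smPos_of_isRowSum`, `smPos_of_isRowSum_of_amPos`,
   `amPos_of_isRowSum`; witnesses add row-wise, `Nat.Partition.rowAdd`) and the discharge
   `GIP2017_prop15_holds : GIP2017_prop15`.
7. (§7) GIP (3.1) `g(λ,μ,μ) = sk(λ,μ) + ak(λ,μ)` as dimensions
   (`kroneckerCoeff_eq_finrank_add_finrank`), so `g(λ,μ,μ) > 0 ⇒ sk > 0 ∨ ak > 0`
   (`skPos_or_akPos_of_kroneckerCoeff_pos`, the step from Cor. 38 to Prop. 19) and conversely; and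
   the doubling `g(λ,μ,μ') > 0 ⇒ sk(λ+λ, μ+μ') > 0` (`skPos_rowAdd_self_of_kroneckerCoeff_pos`: the
   product of an invariant with its own switch is symmetric).

## References

* [GesmundoIkenmeyerPanova2017] F. Gesmundo, C. Ikenmeyer, G. Panova, *Geometric complexity theory
  and matrix powering*, Diff. Geom. Appl. 55 (2017) 106–127 = arXiv:1611.00827, §3: `sk`, `ak`,
  `sm`, `am`, (3.1), Prop. 15 and its proof (held text pp. 9–10), Prop. 19 (proof); §6 (the `ℤ₂`
  switching the last two tensor factors).
* [FultonHarrisGTM129] W. Fulton, J. Harris, *Representation Theory. A First Course*, GTM 129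
  (1991), §2.1 (characters of `Sym²`, `Λ²`; Prop. 2.1), §2.2 (2.9) (`dim V^G = |G|⁻¹ Σ χ`),
  Thm. 6.3 (2) (Schur–Weyl duality).
* [IkenmeyerPanova2017] C. Ikenmeyer, G. Panova, Adv. Math. 319 (2017), §1.1 (the semigroup property
  via highest-weight vectors; the tree's `KroneckerSemigroup.lean`).

## Mathlib and tree

Mathlib: `Representation.card_inv_mul_sum_char_eq_finrank`, `Representation.character`,
`MonoidHom.noncommCoprod` (the `𝔖_n × ℤˣ` action), `Int.units_eq_one_or`, `UnitsInt.univ`,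
`LinearMap.trace_eq_matrix_trace`, `Module.Basis.tensorProduct`, `Module.Basis.map`,
`TensorProduct.assoc`/`congr`, `finAddFlip`. Tree: `KroneckerSemigroup.lean` (`Word3`, `permute3`,
`concat3`, `sym3`, `tripleHw`, `tripleHwRep`, `concat3_mem_tripleHw`, `sym3_mem_tripleHw`,
`sym3_concat3_ne_zero`, `exists_invariant_of_kroneckerCoeff_pos`), `SliceRepresentation.lean`
(`sliceRepEquiv`, `sliceMap_tmul`), `WordHighestWeightSpecht.lean` (`hwPermRep`,
`character_hwPermRep`), `SymmetricGroupRepsKroneckerCharacterProofs.lean`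
(`kroneckerCoeff_eq_sum_spechtCharacter_holds`), `OccurrenceObstructionsIP.lean`
(`Nat.Partition.rowAdd`, `ofPartition_rowAdd`).
-/

noncomputable section

open scoped BigOperators TensorProduct

namespace Literature.Barriers.ValiantsHypothesis

open Literature.NumberTheory.DiophantineGeometry Literature.Computability.Complexity

/-! ### 1. The swap of the last two words of a triple tensor -/

section Swap

variable {k : Type*} [Field k] {N n a b : ℕ}

/-- Swapping the second and third word of a triple. [folklore] -/
def swap3 (t : Word3 N n) : Word3 N n :=
  ((t.1.1, t.2), t.1.2)

/-- `swap3` is an involution. [folklore] -/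
@[simp]
theorem swap3_swap3 (t : Word3 N n) : swap3 (swap3 t) = t :=
  rfl

/-- The diagonal position action commutes with the swap. [folklore] -/
theorem permute3_swap3 (τ : Equiv.Perm (Fin n)) (t : Word3 N n) :
    permute3 τ (swap3 t) = swap3 (permute3 τ t) :=
  rfl

/-- `take3` commutes with the swap. [folklore] -/
theorem take3_swap3 (t : Word3 N (a + b)) : take3 (swap3 t) = swap3 (take3 t) :=
  rfl

/-- `drop3` commutes with the swap. [folklore] -/
theorem drop3_swap3 (t : Word3 N (a + b)) : drop3 (swap3 t) = swap3 (drop3 t) :=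
  rfl

variable (k) in
/-- **The switch of the two copies** `[μ] ⊗ [μ]` on triple tensors, `(s M)((w₁,w₂),w₃) =
M((w₁,w₃),w₂)` (GIP's `ℤ₂ = 𝔖₂` "switching the last two tensor factors", §3 and §6).
[cite: GesmundoIkenmeyerPanova2017, §3 (proof of Prop. 15) and §6] -/
def swapLin : (Word3 N n → k) →ₗ[k] (Word3 N n → k) where
  toFun M t := M (swap3 t)
  map_add' _ _ := rfl
  map_smul' _ _ := rfl

/-- Unfolding lemma for `swapLin`. [folklore] -/
@[simp]
theorem swapLin_apply (M : Word3 N n → k) (t : Word3 N n) : swapLin k M t = M (swap3 t) :=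
  rfl

/-- The switch is an involution. [folklore] -/
theorem swapLin_swapLin (M : Word3 N n → k) : swapLin k (swapLin k M) = M :=
  funext fun _ => rfl

/-- The switch maps `HW_{χ₁} ⊗ HW_{χ₂} ⊗ HW_{χ₃}` to `HW_{χ₁} ⊗ HW_{χ₃} ⊗ HW_{χ₂}`. [folklore] -/
theorem swapLin_mem_tripleHw {χ₁ χ₂ χ₃ : Weight (Fin N)} {M : Word3 N n → k}
    (hM : M ∈ tripleHw k N n χ₁ χ₂ χ₃) : swapLin k M ∈ tripleHw k N n χ₁ χ₃ χ₂ := by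
  rw [mem_tripleHw_iff] at hM ⊢
  obtain ⟨h1, h2, h3⟩ := hM
  exact ⟨fun w₂ w₃ => h1 w₃ w₂, fun w₁ w₃ => h3 w₁ w₃, fun w₁ w₂ => h2 w₁ w₂⟩

/-- The switch of a concatenation product is the concatenation product of the switches.
[folklore] -/
theorem swapLin_concat3 (M : Word3 N a → k) (M' : Word3 N b → k) :
    swapLin k (concat3 M M') = concat3 (swapLin k M) (swapLin k M') :=
  funext fun _ => rfl

/-- The switch commutes with the symmetrisation. [folklore] -/
theorem swapLin_sym3 (H : Word3 N n → k) : swapLin k (sym3 H) = sym3 (swapLin k H) :=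
  funext fun _ => rfl

/-- The switch commutes with the diagonal position action. [folklore] -/
theorem swapLin_permute3 (M : Word3 N n → k) (τ : Equiv.Perm (Fin n)) :
    swapLin k (fun t => M (permute3 τ t)) = fun t => swapLin k M (permute3 τ t) :=
  funext fun _ => rfl

/-- **Switch-parity is multiplicative under the symmetrised concatenation product**: if
`s M = ε M` and `s M' = ε' M'` then `s (∑_τ τ · (M ⊙ M')) = ε ε' ∑_τ τ · (M ⊙ M')` ("if `f` and
`g` are both `𝔖₂`-invariant, then their product `fg` is `𝔖₂`-invariant. But if `f` and `g` are
both `𝔖₂`-skew-invariant, then `fg` is also `𝔖₂`-invariant. Moreover, if `f` is `𝔖₂`-invariant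
and `g` is `𝔖₂`-skew-invariant, then `fg` is `𝔖₂`-skew-invariant", GIP p. 10).
[cite: GesmundoIkenmeyerPanova2017, Prop. 15 (proof)] -/
theorem swapLin_sym3_concat3 {ε ε' : k} {M : Word3 N a → k} {M' : Word3 N b → k}
    (hM : swapLin k M = ε • M) (hM' : swapLin k M' = ε' • M') :
    swapLin k (sym3 (concat3 M M')) = (ε * ε') • sym3 (concat3 M M') := by
  rw [swapLin_sym3, swapLin_concat3, hM, hM']
  funext t
  simp only [sym3, concat3, Pi.smul_apply, smul_eq_mul, Finset.mul_sum]
  refine Finset.sum_congr rfl fun τ _ => ?_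
  ring

end Swap


/-! ### 2. The switch on `HW_{χ₁} ⊗ HW_{χ₂} ⊗ HW_{χ₂}` and the twisted action of `𝔖_n × ℤˣ` -/

section Twisted

variable (k : Type*) [Field k] (N n : ℕ) (χ₁ χ₂ : Weight (Fin N))

/-- The switch restricted to the triple slice space `T = HW_{χ₁} ⊗ HW_{χ₂} ⊗ HW_{χ₂}` (equal second
and third weights). [cite: GesmundoIkenmeyerPanova2017, §3 (proof of Prop. 15: the 𝔖₂ action)] -/
def swapT : tripleHw k N n χ₁ χ₂ χ₂ →ₗ[k] tripleHw k N n χ₁ χ₂ χ₂ :=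
  (swapLin k).restrict fun _ hM => swapLin_mem_tripleHw hM

variable {k N n χ₁ χ₂}

/-- `swapT` acts as `swapLin` on underlying functions (unfolding lemma). [folklore] -/
@[simp]
theorem coe_swapT_apply (M : tripleHw k N n χ₁ χ₂ χ₂) :
    ((swapT k N n χ₁ χ₂ M : tripleHw k N n χ₁ χ₂ χ₂) : Word3 N n → k) = swapLin k M :=
  rfl

/-- `swapT` is an involution. [folklore] -/
theorem swapT_swapT (M : tripleHw k N n χ₁ χ₂ χ₂) :
    swapT k N n χ₁ χ₂ (swapT k N n χ₁ χ₂ M) = M :=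
  Subtype.ext (swapLin_swapLin _)

/-- `swapT² = 1` in `End(T)`. [folklore] -/
theorem swapT_mul_swapT : swapT k N n χ₁ χ₂ * swapT k N n χ₁ χ₂ = 1 :=
  LinearMap.ext fun M => swapT_swapT M

/-- The switch commutes with the diagonal position action of `𝔖_n` ("the action of `𝔖_d`
commutes with the actions of `GL³` and `𝔖₂`", GIP p. 9). [cite: GesmundoIkenmeyerPanova2017, §3 (proof of Prop. 15)] -/
theorem tripleHwRep_mul_swapT (τ : Equiv.Perm (Fin n)) :
    tripleHwRep k N n χ₁ χ₂ χ₂ τ * swapT k N n χ₁ χ₂ = swapT k N n χ₁ χ₂ * tripleHwRep k N n χ₁ χ₂ χ₂ τ := by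
  apply LinearMap.ext
  intro M
  apply Subtype.ext
  funext t
  change ((tripleHwRep k N n χ₁ χ₂ χ₂ τ (swapT k N n χ₁ χ₂ M) : tripleHw k N n χ₁ χ₂ χ₂) :
      Word3 N n → k) t =
    ((swapT k N n χ₁ χ₂ (tripleHwRep k N n χ₁ χ₂ χ₂ τ M) : tripleHw k N n χ₁ χ₂ χ₂) :
      Word3 N n → k) t
  rw [coe_tripleHwRep_apply, coe_swapT_apply, swapLin_apply, coe_swapT_apply, swapLin_apply,
    coe_tripleHwRep_apply]
  rfl

variable (k N n χ₁ χ₂)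

/-- The `ℤˣ = {±1}` part of the twisted action: `1 ↦ 1`, `-1 ↦ ε · s` for a sign `ε` (`ε² = 1`;
`ε = 1`: the switch, whose invariants are the SYMMETRIC tensors; `ε = -1`: minus the switch, whose
invariants are the skew tensors). [cite: GesmundoIkenmeyerPanova2017, §3 (proof of Prop. 15: 𝔖₂-invariants and skew-invariants)] -/
def signSwapHom (ε : k) (hε : ε * ε = 1) : ℤˣ →* Module.End k (tripleHw k N n χ₁ χ₂ χ₂) where
  toFun u := if u = 1 then 1 else ε • swapT k N n χ₁ χ₂
  map_one' := if_pos rfl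
  map_mul' u v := by
    have hne : (-1 : ℤˣ) ≠ 1 := by decide
    have hsq : ((-1 : ℤˣ) * -1) = 1 := by decide
    rcases Int.units_eq_one_or u with rfl | rfl <;> rcases Int.units_eq_one_or v with rfl | rfl
    · simp
    · simp [hne]
    · simp [hne]
    · rw [if_pos hsq, if_neg hne, Algebra.smul_mul_assoc, Algebra.mul_smul_comm, smul_smul, hε,
        one_smul, swapT_mul_swapT]

/-- `signSwapHom 1 = 1`. [folklore] -/
@[simp]
theorem signSwapHom_one (ε : k) (hε : ε * ε = 1) : signSwapHom k N n χ₁ χ₂ ε hε 1 = 1 :=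
  map_one _

/-- `signSwapHom (-1) = ε · s`. [folklore] -/
@[simp]
theorem signSwapHom_neg_one (ε : k) (hε : ε * ε = 1) :
    signSwapHom k N n χ₁ χ₂ ε hε (-1) = ε • swapT k N n χ₁ χ₂ := by
  show (if (-1 : ℤˣ) = 1 then (1 : Module.End k (tripleHw k N n χ₁ χ₂ χ₂))
    else ε • swapT k N n χ₁ χ₂) = _
  rw [if_neg (by decide)]

/-- **The twisted representation** of `𝔖_n × ℤˣ` on `T = HW_{χ₁} ⊗ HW_{χ₂} ⊗ HW_{χ₂}`:
`(σ, u) ↦ σ ∘ (ε s)^{[u = -1]}` (the two actions commute). Its invariants are the `𝔖_n`-invariant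
tensors `M` with `s M = ε M` (`mem_invariants_twistedRep_iff`), i.e. for weights of partitions
`λ, μ` the space `([λ] ⊗ S²[μ])^{𝔖_n}` (`ε = 1`) or `([λ] ⊗ Λ²[μ])^{𝔖_n}` (`ε = -1`) of GIP §3.
[cite: GesmundoIkenmeyerPanova2017, §3 (sk(λ,μ) = dim([λ]⊗S²[μ])^{𝔖_D}, ak(λ,μ) = dim([λ]⊗Λ²[μ])^{𝔖_D})] -/
def twistedRep (ε : k) (hε : ε * ε = 1) :
    Representation k (Equiv.Perm (Fin n) × ℤˣ) (tripleHw k N n χ₁ χ₂ χ₂) :=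
  MonoidHom.noncommCoprod (tripleHwRep k N n χ₁ χ₂ χ₂) (signSwapHom k N n χ₁ χ₂ ε hε) fun σ u => by
    rcases Int.units_eq_one_or u with rfl | rfl
    · rw [map_one]
      exact Commute.one_right _
    · rw [signSwapHom_neg_one]
      exact (show Commute (tripleHwRep k N n χ₁ χ₂ χ₂ σ) (swapT k N n χ₁ χ₂) from
        tripleHwRep_mul_swapT σ).smul_right ε

variable {k N n χ₁ χ₂}

/-- Unfolding lemma for `twistedRep`. [folklore] -/
theorem twistedRep_apply (ε : k) (hε : ε * ε = 1) (σ : Equiv.Perm (Fin n)) (u : ℤˣ) :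
    twistedRep k N n χ₁ χ₂ ε hε (σ, u) =
      tripleHwRep k N n χ₁ χ₂ χ₂ σ * signSwapHom k N n χ₁ χ₂ ε hε u := by
  simp only [twistedRep, MonoidHom.noncommCoprod_apply]

/-- **Invariants of the twisted representation** = `𝔖_n`-invariant tensors of switch-parity `ε`.
[cite: GesmundoIkenmeyerPanova2017, §3 (proof of Prop. 15)] -/
theorem mem_invariants_twistedRep_iff (ε : k) (hε : ε * ε = 1) (v : tripleHw k N n χ₁ χ₂ χ₂) :
    v ∈ (twistedRep k N n χ₁ χ₂ ε hε).invariants ↔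
      (∀ σ, tripleHwRep k N n χ₁ χ₂ χ₂ σ v = v) ∧ swapT k N n χ₁ χ₂ v = ε • v := by
  rw [Representation.mem_invariants]
  constructor
  · intro h
    refine ⟨fun σ => ?_, ?_⟩
    · have := h (σ, 1)
      rwa [twistedRep_apply, signSwapHom_one, mul_one] at this
    · have h1 := h (1, -1)
      rw [twistedRep_apply, map_one, one_mul, signSwapHom_neg_one, LinearMap.smul_apply] at h1
      calc swapT k N n χ₁ χ₂ v = (ε * ε) • swapT k N n χ₁ χ₂ v := by rw [hε, one_smul]
        _ = ε • ε • swapT k N n χ₁ χ₂ v := mul_smul _ _ _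
        _ = ε • v := by rw [h1]
  · rintro ⟨hσ, hs⟩ ⟨σ, u⟩
    rw [twistedRep_apply, Module.End.mul_apply]
    rcases Int.units_eq_one_or u with rfl | rfl
    · rw [signSwapHom_one, Module.End.one_apply, hσ]
    · rw [signSwapHom_neg_one, LinearMap.smul_apply, hs, smul_smul, hε, one_smul, hσ]

end Twisted

/-! ### 3. The character of the twisted representation -/

section Character

variable {k : Type*} [Field k] {N n : ℕ} (χ₁ χ₂ : Weight (Fin N))

/-- Stability of `HW_χ` under `𝔖_n` (abbreviation of the tree lemma, fixing the implicit
arguments). [folklore] -/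
theorem hwStable (χ : Weight (Fin N)) :
    ∀ τ : Equiv.Perm (Fin n), highestWeightSpace (wordRep k N n) χ ≤
      (highestWeightSpace (wordRep k N n) χ).comap (wordPermRep k N n τ) :=
  highestWeightSpace_le_comap_wordPermRep k (D := n) χ

/-- **`HW_{χ₁} ⊗ (HW_{χ₂} ⊗ HW_{χ₂}) ≃ T`**, the coordinate isomorphism onto the triple slice space
(the tree's `sliceRepEquiv` twice, after reassociating): `x ⊗ (y ⊗ z) ↦ ((w₁,w₂),w₃) ↦
x(w₁) y(w₂) z(w₃)` (`coe_tripleEquivLin_tmul`). [folklore] -/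
def tripleEquivLin :
    (highestWeightSpace (wordRep k N n) χ₁) ⊗[k] ((highestWeightSpace (wordRep k N n) χ₂) ⊗[k]
        (highestWeightSpace (wordRep k N n) χ₂)) ≃ₗ[k] tripleHw k N n χ₁ χ₂ χ₂ :=
  (TensorProduct.assoc k _ _ _).symm.trans
    ((TensorProduct.congr (sliceRepEquiv (hwStable (k := k) (n := n) χ₁) (hwStable χ₂)).toLinearEquiv
        (LinearEquiv.refl k _)).trans
      (sliceRepEquiv (sliceSubmodule_le_comap_pairRep (hwStable (k := k) (n := n) χ₁) (hwStable χ₂))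
        (hwStable χ₂)).toLinearEquiv)

/-- The coordinate isomorphism on pure tensors. [folklore] -/
theorem coe_tripleEquivLin_tmul (x : highestWeightSpace (wordRep k N n) χ₁)
    (y z : highestWeightSpace (wordRep k N n) χ₂) :
    ((tripleEquivLin χ₁ χ₂ (x ⊗ₜ (y ⊗ₜ z)) : tripleHw k N n χ₁ χ₂ χ₂) : Word3 N n → k) =
      fun t => (x : Word N n → k) t.1.1 * (y : Word N n → k) t.1.2 * (z : Word N n → k) t.2 := by
  funext t
  simp only [tripleEquivLin, LinearEquiv.trans_apply, TensorProduct.assoc_symm_tmul,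
    TensorProduct.congr_tmul, LinearEquiv.refl_apply]
  change sliceMap _ _ ((sliceRepEquiv (hwStable (k := k) (n := n) χ₁) (hwStable χ₂)).toLinearEquiv
    (x ⊗ₜ y) ⊗ₜ z) t = _
  rw [sliceMap_tmul]
  change sliceMap _ _ (x ⊗ₜ y) t.1 * (z : Word N n → k) t.2 = _
  rw [sliceMap_tmul]

/-- **The coordinate isomorphism is `𝔖_n`-equivariant**: `σ · Φ(x ⊗ (y ⊗ z)) = Φ(σx ⊗ (σy ⊗ σz))`.
[folklore] -/
theorem tripleHwRep_tripleEquivLin_tmul (σ : Equiv.Perm (Fin n))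
    (x : highestWeightSpace (wordRep k N n) χ₁) (y z : highestWeightSpace (wordRep k N n) χ₂) :
    tripleHwRep k N n χ₁ χ₂ χ₂ σ (tripleEquivLin χ₁ χ₂ (x ⊗ₜ (y ⊗ₜ z))) =
      tripleEquivLin χ₁ χ₂ (hwPermRep k (D := n) χ₁ σ x ⊗ₜ (hwPermRep k (D := n) χ₂ σ y ⊗ₜ
        hwPermRep k (D := n) χ₂ σ z)) := by
  apply Subtype.ext
  rw [coe_tripleEquivLin_tmul]
  funext t
  rw [coe_tripleHwRep_apply, coe_tripleEquivLin_tmul]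
  simp only [coe_hwPermRep_apply, wordPerm_apply]
  rfl

/-- **The switch corresponds to `x ⊗ (y ⊗ z) ↦ x ⊗ (z ⊗ y)`** under the coordinate isomorphism.
[folklore] -/
theorem swapT_tripleEquivLin_tmul (x : highestWeightSpace (wordRep k N n) χ₁)
    (y z : highestWeightSpace (wordRep k N n) χ₂) :
    swapT k N n χ₁ χ₂ (tripleEquivLin χ₁ χ₂ (x ⊗ₜ (y ⊗ₜ z))) = tripleEquivLin χ₁ χ₂ (x ⊗ₜ (z ⊗ₜ y)) := by
  apply Subtype.ext
  rw [coe_tripleEquivLin_tmul, coe_swapT_apply, coe_tripleEquivLin_tmul]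
  funext t
  simp only [swapLin_apply, swap3]
  ring

/-- **The character of `T`: `tr(σ | T) = χ₁(σ) χ₂(σ)²`**, computed in the basis of `T` transported
from bases of `HW_{χ₁}`, `HW_{χ₂}` along the coordinate isomorphism (the diagonal entry at
`(i, j, l)` is `A_{ii} B_{jj} B_{ll}`, `A = σ|HW_{χ₁}`, `B = σ|HW_{χ₂}`); `χ_{V ⊗ W} = χ_V χ_W`
(Fulton–Harris Prop. 2.1). [cite: FultonHarrisGTM129, §2.1 Prop. 2.1] -/
theorem trace_tripleHwRep (σ : Equiv.Perm (Fin n)) :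
    LinearMap.trace k _ (tripleHwRep k N n χ₁ χ₂ χ₂ σ) =
      (hwPermRep k (D := n) χ₁).character σ * ((hwPermRep k (D := n) χ₂).character σ *
        (hwPermRep k (D := n) χ₂).character σ) := by
  classical
  set b₁ := Module.finBasis k (highestWeightSpace (wordRep k N n) χ₁) with hb₁
  set b₂ := Module.finBasis k (highestWeightSpace (wordRep k N n) χ₂) with hb₂
  set bT := (b₁.tensorProduct (b₂.tensorProduct b₂)).map (tripleEquivLin (k := k) (n := n) χ₁ χ₂)
    with hbT
  rw [LinearMap.trace_eq_matrix_trace k bT, Representation.character, Representation.character,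
    LinearMap.trace_eq_matrix_trace k b₁, LinearMap.trace_eq_matrix_trace k b₂]
  simp only [Matrix.trace, Matrix.diag_apply, LinearMap.toMatrix_apply, Fintype.sum_prod_type]
  simp only [hbT, Module.Basis.map_apply, Module.Basis.map_repr, LinearEquiv.trans_apply,
    Module.Basis.tensorProduct_apply, tripleHwRep_tripleEquivLin_tmul, LinearEquiv.symm_apply_apply,
    Module.Basis.tensorProduct_repr_tmul_apply, smul_eq_mul]
  rw [Finset.sum_mul]
  refine Finset.sum_congr rfl fun i _ => ?_
  rw [Finset.sum_mul_sum, Finset.mul_sum]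
  refine Finset.sum_congr rfl fun j _ => ?_
  rw [Finset.mul_sum]
  refine Finset.sum_congr rfl fun l _ => ?_
  ring

/-- **The character of `σ ∘ s`: `tr(σ ∘ s | T) = χ₁(σ) · χ₂(σ²)`** (same basis; the diagonal entry
at `(i, j, l)` is `A_{ii} B_{jl} B_{lj}`, and `Σ_{j,l} B_{jl} B_{lj} = tr(B²)`). This is the
computation behind `χ_{S²[μ]}(σ) = (χ^μ(σ)² + χ^μ(σ²))/2` (Fulton–Harris §2.1).
[cite: FultonHarrisGTM129, §2.1 (characters of Sym² and Λ²)] -/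
theorem trace_tripleHwRep_comp_swapT (σ : Equiv.Perm (Fin n)) :
    LinearMap.trace k _ (tripleHwRep k N n χ₁ χ₂ χ₂ σ ∘ₗ swapT k N n χ₁ χ₂) =
      (hwPermRep k (D := n) χ₁).character σ * (hwPermRep k (D := n) χ₂).character (σ * σ) := by
  classical
  set b₁ := Module.finBasis k (highestWeightSpace (wordRep k N n) χ₁) with hb₁
  set b₂ := Module.finBasis k (highestWeightSpace (wordRep k N n) χ₂) with hb₂
  set bT := (b₁.tensorProduct (b₂.tensorProduct b₂)).map (tripleEquivLin (k := k) (n := n) χ₁ χ₂)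
    with hbT
  rw [LinearMap.trace_eq_matrix_trace k bT, Representation.character, Representation.character,
    LinearMap.trace_eq_matrix_trace k b₁, LinearMap.trace_eq_matrix_trace k b₂, map_mul,
    LinearMap.toMatrix_mul]
  simp only [Matrix.trace, Matrix.diag_apply, Matrix.mul_apply, LinearMap.toMatrix_apply,
    Fintype.sum_prod_type]
  simp only [hbT, Module.Basis.map_apply, Module.Basis.map_repr, LinearEquiv.trans_apply,
    LinearMap.comp_apply, Module.Basis.tensorProduct_apply, swapT_tripleEquivLin_tmul,
    tripleHwRep_tripleEquivLin_tmul, LinearEquiv.symm_apply_apply,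
    Module.Basis.tensorProduct_repr_tmul_apply, smul_eq_mul]
  rw [Finset.sum_mul]
  refine Finset.sum_congr rfl fun i _ => ?_
  rw [Finset.mul_sum]
  refine Finset.sum_congr rfl fun j _ => ?_
  rw [Finset.mul_sum]
  refine Finset.sum_congr rfl fun l _ => ?_
  ring

/-- **The character of the twisted representation**: `χ((σ, 1)) = χ₁(σ) χ₂(σ)²` and
`χ((σ, -1)) = ε χ₁(σ) χ₂(σ²)`. [cite: FultonHarrisGTM129, §2.1 (characters of Sym² and Λ²)] -/
theorem character_twistedRep (ε : k) (hε : ε * ε = 1) (σ : Equiv.Perm (Fin n)) :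
    (twistedRep k N n χ₁ χ₂ ε hε).character (σ, 1) =
        (hwPermRep k (D := n) χ₁).character σ * ((hwPermRep k (D := n) χ₂).character σ *
          (hwPermRep k (D := n) χ₂).character σ) ∧
      (twistedRep k N n χ₁ χ₂ ε hε).character (σ, -1) =
        ε * ((hwPermRep k (D := n) χ₁).character σ *
          (hwPermRep k (D := n) χ₂).character (σ * σ)) := by
  constructor
  · rw [Representation.character, twistedRep_apply, signSwapHom_one, mul_one, trace_tripleHwRep]
  · rw [Representation.character, twistedRep_apply, signSwapHom_neg_one, Algebra.mul_smul_comm,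
      map_smul, smul_eq_mul, Module.End.mul_eq_comp, trace_tripleHwRep_comp_swapT]

end Character

/-! ### 4. `2·n!·dim T^{𝔖_n × ℤˣ} = Σ_σ χ^λ(σ)(χ^μ(σ)² + ε χ^μ(σ²))`: the bridge to `sk` and `ak` -/

section Bridge

variable {k : Type*} [Field k] [CharZero k] {N n : ℕ}

/-- **The invariant-dimension formula for the twisted representation**: for partitions `λ, μ ⊢ n`
with at most `N` parts, `2·n!·dim (HW_λ ⊗ HW_μ ⊗ HW_μ)^{𝔖_n × ℤˣ} =
Σ_σ χ^λ(σ) (χ^μ(σ)² + ε χ^μ(σ²))` (`dim V^G = |G|⁻¹ Σ_g χ_V(g)`, Fulton–Harris (2.9), with the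
character of §3 and Schur–Weyl duality `χ_{HW_μ} = χ^μ`, `character_hwPermRep`). For `ε = 1` the
right side is `skCharSum λ μ = 2·n!·sk(λ, μ)`, for `ε = -1` it is `akCharSum λ μ = 2·n!·ak(λ, μ)`
(GIP §3: `sk(λ, μ) = dim([λ] ⊗ S²[μ])^{𝔖_D}`, `ak(λ, μ) = dim([λ] ⊗ Λ²[μ])^{𝔖_D}`).
[cite: GesmundoIkenmeyerPanova2017, §3 (sk, ak as invariant dimensions)] [cite: FultonHarrisGTM129, §2.2 (2.9) and §2.1] -/
theorem card_mul_finrank_invariants_twistedRep (lam mu : Nat.Partition n)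
    (hl : lam.parts.card ≤ N) (hm : mu.parts.card ≤ N) (ε : k) (hε : ε * ε = 1) :
    ((2 * n.factorial : ℕ) : k) *
        (Module.finrank k (twistedRep k N n (Weight.ofPartition N lam) (Weight.ofPartition N mu)
          ε hε).invariants : k) =
      ∑ σ : Equiv.Perm (Fin n), spechtCharacter k lam σ *
        (spechtCharacter k mu σ ^ 2 + ε * spechtCharacter k mu (σ * σ)) := by
  have hcard : Nat.card (Equiv.Perm (Fin n) × ℤˣ) = 2 * n.factorial := by
    rw [Nat.card_eq_fintype_card, Fintype.card_prod, Fintype.card_perm, Fintype.card_fin,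
      Fintype.card_units_int, mul_comm]
  have hne : ((2 * n.factorial : ℕ) : k) ≠ 0 := by
    exact_mod_cast (by positivity : 2 * n.factorial ≠ 0)
  haveI : Invertible (Nat.card (Equiv.Perm (Fin n) × ℤˣ) : k) :=
    invertibleOfNonzero (by rw [hcard]; exact hne)
  have h := Representation.card_inv_mul_sum_char_eq_finrank
    (twistedRep k N n (Weight.ofPartition N lam) (Weight.ofPartition N mu) ε hε)
  rw [hcard] at h
  rw [← h, ← mul_assoc, mul_inv_cancel₀ hne, one_mul, Fintype.sum_prod_type]
  refine Finset.sum_congr rfl fun σ _ => ?_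
  rw [UnitsInt.univ, Finset.sum_insert (by decide), Finset.sum_singleton,
    (character_twistedRep _ _ ε hε σ).1, (character_twistedRep _ _ ε hε σ).2,
    character_hwPermRep k lam hl, character_hwPermRep k mu hm]
  ring

omit [CharZero k] in
/-- **Nonzero invariants of the twisted representation are exactly the nonzero `𝔖_n`-invariant
triple tensors of switch-parity `ε`** (as functions on triples of words). [folklore] -/
theorem finrank_invariants_twistedRep_ne_zero_iff (χ₁ χ₂ : Weight (Fin N)) (ε : k)
    (hε : ε * ε = 1) :
    Module.finrank k (twistedRep k N n χ₁ χ₂ ε hε).invariants ≠ 0 ↔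
      ∃ M : Word3 N n → k, M ∈ tripleHw k N n χ₁ χ₂ χ₂ ∧ M ≠ 0 ∧
        (∀ τ t, M (permute3 τ t) = M t) ∧ ∀ t, M (swap3 t) = ε * M t := by
  rw [Ne, Submodule.finrank_eq_zero, ← Ne, Submodule.ne_bot_iff]
  constructor
  · rintro ⟨v, hv, hv0⟩
    rw [mem_invariants_twistedRep_iff] at hv
    refine ⟨(v : Word3 N n → k), v.2, fun h0 => hv0 (Subtype.ext h0), fun τ t => ?_, fun t => ?_⟩
    · have := congrArg (fun y : tripleHw k N n χ₁ χ₂ χ₂ => (y : Word3 N n → k) t) (hv.1 τ)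
      rwa [coe_tripleHwRep_apply] at this
    · have := congrArg (fun y : tripleHw k N n χ₁ χ₂ χ₂ => (y : Word3 N n → k) t) hv.2
      simpa only [coe_swapT_apply, swapLin_apply, Submodule.coe_smul, Pi.smul_apply,
        smul_eq_mul] using this
  · rintro ⟨M, hM, hM0, hinv, hsw⟩
    refine ⟨⟨M, hM⟩, ?_, fun h0 => hM0 (congrArg Subtype.val h0)⟩
    rw [mem_invariants_twistedRep_iff]
    refine ⟨fun τ => Subtype.ext (funext fun t => ?_), Subtype.ext (funext fun t => ?_)⟩
    · rw [coe_tripleHwRep_apply]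
      exact hinv τ t
    · rw [coe_swapT_apply, swapLin_apply, Submodule.coe_smul, Pi.smul_apply, smul_eq_mul]
      exact hsw t

/-- **`skCharSum λ μ = 2·n!·dim (HW_λ ⊗ HW_μ ⊗ HW_μ)^{𝔖_n × ℤˣ}`** (symmetric twist, over `ℂ`):
the character sum defining `SkPos` IS `2·n!·sk(λ, μ)` with `sk(λ, μ) = dim([λ] ⊗ S²[μ])^{𝔖_n}`
realised on triple tensors. [cite: GesmundoIkenmeyerPanova2017, §2.1 and §3 (sk)] -/
theorem skCharSum_eq_card_mul_finrank (lam mu : Nat.Partition n) (hl : lam.parts.card ≤ N)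
    (hm : mu.parts.card ≤ N) :
    skCharSum lam mu = ((2 * n.factorial : ℕ) : ℂ) *
      (Module.finrank ℂ (twistedRep ℂ N n (Weight.ofPartition N lam) (Weight.ofPartition N mu)
        1 (one_mul 1)).invariants : ℂ) := by
  rw [card_mul_finrank_invariants_twistedRep lam mu hl hm 1 (one_mul 1), skCharSum]
  simp only [one_mul]

/-- **`akCharSum λ μ = 2·n!·dim (HW_λ ⊗ HW_μ ⊗ HW_μ)^{𝔖_n × ℤˣ}`** (skew twist, over `ℂ`):
`2·n!·ak(λ, μ)`, `ak(λ, μ) = dim([λ] ⊗ Λ²[μ])^{𝔖_n}`. [cite: GesmundoIkenmeyerPanova2017, §3 (ak)] -/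
theorem akCharSum_eq_card_mul_finrank (lam mu : Nat.Partition n) (hl : lam.parts.card ≤ N)
    (hm : mu.parts.card ≤ N) :
    akCharSum lam mu = ((2 * n.factorial : ℕ) : ℂ) *
      (Module.finrank ℂ (twistedRep ℂ N n (Weight.ofPartition N lam) (Weight.ofPartition N mu)
        (-1) (by norm_num)).invariants : ℂ) := by
  rw [card_mul_finrank_invariants_twistedRep lam mu hl hm (-1) (by norm_num), akCharSum]
  refine Finset.sum_congr rfl fun σ _ => ?_
  ring

/-- **`sk(λ, μ) > 0` iff there is a nonzero SYMMETRIC `𝔖_n`-invariant tensor in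
`HW_λ ⊗ HW_μ ⊗ HW_μ`** (for any `N` bounding the parts; the word-model form of
`sk(λ, μ) = dim([λ] ⊗ S²[μ])^{𝔖_D}`). [cite: GesmundoIkenmeyerPanova2017, §3 (sk = dim([λ]⊗S²[μ])^{𝔖_D})] -/
theorem skPos_iff_exists (lam mu : Nat.Partition n) (hl : lam.parts.card ≤ N)
    (hm : mu.parts.card ≤ N) :
    SkPos lam mu ↔ ∃ M : Word3 N n → ℂ, M ∈ tripleHw ℂ N n (Weight.ofPartition N lam)
      (Weight.ofPartition N mu) (Weight.ofPartition N mu) ∧ M ≠ 0 ∧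
        (∀ τ t, M (permute3 τ t) = M t) ∧ ∀ t, M (swap3 t) = M t := by
  rw [SkPos, skCharSum_eq_card_mul_finrank lam mu hl hm, mul_ne_zero_iff, Nat.cast_ne_zero,
    Nat.cast_ne_zero, finrank_invariants_twistedRep_ne_zero_iff]
  simp only [one_mul]
  exact ⟨fun h => h.2, fun h => ⟨by positivity, h⟩⟩

/-- **`ak(λ, μ) > 0` iff there is a nonzero SKEW `𝔖_n`-invariant tensor in `HW_λ ⊗ HW_μ ⊗ HW_μ`**
(the word-model form of `ak(λ, μ) = dim([λ] ⊗ Λ²[μ])^{𝔖_D}`). [cite: GesmundoIkenmeyerPanova2017, §3 (ak = dim([λ]⊗Λ²[μ])^{𝔖_D})] -/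
theorem akPos_iff_exists (lam mu : Nat.Partition n) (hl : lam.parts.card ≤ N)
    (hm : mu.parts.card ≤ N) :
    AkPos lam mu ↔ ∃ M : Word3 N n → ℂ, M ∈ tripleHw ℂ N n (Weight.ofPartition N lam)
      (Weight.ofPartition N mu) (Weight.ofPartition N mu) ∧ M ≠ 0 ∧
        (∀ τ t, M (permute3 τ t) = M t) ∧ ∀ t, M (swap3 t) = -M t := by
  rw [AkPos, akCharSum_eq_card_mul_finrank lam mu hl hm, mul_ne_zero_iff, Nat.cast_ne_zero,
    Nat.cast_ne_zero, finrank_invariants_twistedRep_ne_zero_iff]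
  simp only [neg_one_mul]
  exact ⟨fun h => h.2, fun h => ⟨by positivity, h⟩⟩

end Bridge

/-! ### 5. Multiplying invariant tensors: the semigroup property of `sk`, `ak` -/

section Semigroup

variable {k : Type*} [Field k] [CharZero k] {N a b : ℕ}

/-- **Products of twisted invariants** (the word-model core of GIP Prop. 15): nonzero `𝔖_a`- and
`𝔖_b`-invariant triple tensors of weights `(χ₁, χ₂, χ₂)`, `(ψ₁, ψ₂, ψ₂)` and switch-parities
`ε`, `ε'` have the nonzero `𝔖_{a+b}`-invariant symmetrised concatenation product of weights
`(χ₁ + ψ₁, χ₂ + ψ₂, χ₂ + ψ₂)` and parity `ε ε'` ("multiplying two highest weight vector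
polynomials ... If `f` and `g` are both `𝔖₂`-invariant, then their product `fg` is `𝔖₂`-invariant",
GIP p. 10; the tree's `concat3_mem_tripleHw`, `sym3_mem_tripleHw`, `sym3_concat3_ne_zero`).
[cite: GesmundoIkenmeyerPanova2017, Prop. 15 (proof)] -/
theorem exists_twisted_invariant_mul {χ₁ χ₂ ψ₁ ψ₂ : Weight (Fin N)} {ε ε' : k}
    (h : ∃ M : Word3 N a → k, M ∈ tripleHw k N a χ₁ χ₂ χ₂ ∧ M ≠ 0 ∧
      (∀ τ t, M (permute3 τ t) = M t) ∧ ∀ t, M (swap3 t) = ε * M t)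
    (h' : ∃ M' : Word3 N b → k, M' ∈ tripleHw k N b ψ₁ ψ₂ ψ₂ ∧ M' ≠ 0 ∧
      (∀ τ t, M' (permute3 τ t) = M' t) ∧ ∀ t, M' (swap3 t) = ε' * M' t) :
    ∃ P : Word3 N (a + b) → k, P ∈ tripleHw k N (a + b) (χ₁ + ψ₁) (χ₂ + ψ₂) (χ₂ + ψ₂) ∧ P ≠ 0 ∧
      (∀ τ t, P (permute3 τ t) = P t) ∧ ∀ t, P (swap3 t) = ε * ε' * P t := by
  obtain ⟨M, hM, hM0, hMi, hMs⟩ := h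
  obtain ⟨M', hM', hM0', hMi', hMs'⟩ := h'
  refine ⟨sym3 (concat3 M M'), sym3_mem_tripleHw (concat3_mem_tripleHw hM hM'),
    sym3_concat3_ne_zero hMi hMi' hM0 hM0', fun τ t => sym3_permute3 _ τ t, fun t => ?_⟩
  have hs : swapLin k M = ε • M :=
    funext fun t => by rw [swapLin_apply, hMs, Pi.smul_apply, smul_eq_mul]
  have hs' : swapLin k M' = ε' • M' :=
    funext fun t => by rw [swapLin_apply, hMs', Pi.smul_apply, smul_eq_mul]
  have := congrFun (swapLin_sym3_concat3 hs hs') t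
  rwa [swapLin_apply, Pi.smul_apply, smul_eq_mul] at this

variable {c : ℕ}

/-- A row-wise sum of a partition of `a` and a partition of `b` is a partition of `a + b`.
[folklore] -/
theorem IsRowSum.eq_add {Lam : Nat.Partition c} {lam : Nat.Partition a} {lam' : Nat.Partition b}
    (h : IsRowSum Lam lam lam') : c = a + b := by
  have e1 := sum_range_getD_sortedParts_of_le Lam
    (le_max_left Lam.parts.card (max lam.parts.card lam'.parts.card))
  have e2 := sum_range_getD_sortedParts_of_le lam ((le_max_left _ lam'.parts.card).trans
    (le_max_right Lam.parts.card (max lam.parts.card lam'.parts.card)))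
  have e3 := sum_range_getD_sortedParts_of_le lam' ((le_max_right lam.parts.card _).trans
    (le_max_right Lam.parts.card (max lam.parts.card lam'.parts.card)))
  have e4 : (∑ r ∈ Finset.range (max Lam.parts.card (max lam.parts.card lam'.parts.card)),
      Lam.sortedParts.getD r 0) =
      (∑ r ∈ Finset.range (max Lam.parts.card (max lam.parts.card lam'.parts.card)),
        lam.sortedParts.getD r 0) +
      ∑ r ∈ Finset.range (max Lam.parts.card (max lam.parts.card lam'.parts.card)),
        lam'.sortedParts.getD r 0 := by
    rw [← Finset.sum_add_distrib]
    exact Finset.sum_congr rfl fun r _ => h r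
  omega

/-- The `GL_N`-weight of a row-wise sum is the sum of the weights. [folklore] -/
theorem IsRowSum.ofPartition_eq {Lam : Nat.Partition c} {lam : Nat.Partition a}
    {lam' : Nat.Partition b} (h : IsRowSum Lam lam lam') (N : ℕ) :
    Weight.ofPartition N Lam = Weight.ofPartition N lam + Weight.ofPartition N lam' :=
  funext fun i => by simp only [Weight.ofPartition_apply, Pi.add_apply, h i, Nat.cast_add]

/-- There is an `N` bounding the parts of six given partitions. [folklore] -/
theorem exists_parts_card_le₆ {d₁ d₂ d₃ d₄ d₅ d₆ : ℕ} (p₁ : Nat.Partition d₁) (p₂ : Nat.Partition d₂)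
    (p₃ : Nat.Partition d₃) (p₄ : Nat.Partition d₄) (p₅ : Nat.Partition d₅) (p₆ : Nat.Partition d₆) :
    ∃ N, p₁.parts.card ≤ N ∧ p₂.parts.card ≤ N ∧ p₃.parts.card ≤ N ∧ p₄.parts.card ≤ N ∧
      p₅.parts.card ≤ N ∧ p₆.parts.card ≤ N :=
  ⟨p₁.parts.card + p₂.parts.card + p₃.parts.card + p₄.parts.card + p₅.parts.card + p₆.parts.card,
    by omega, by omega, by omega, by omega, by omega, by omega⟩

/-- **Semigroup property of the symmetric Kronecker coefficients**: `sk(λ, μ) > 0` and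
`sk(λ', μ') > 0` imply `sk(λ + λ', μ + μ') > 0` (row-wise sums). This sharpens GIP Prop. 15(1),
which sums over `μ`; the proof is theirs (multiply the two symmetric invariants).
[cite: GesmundoIkenmeyerPanova2017, Prop. 15(1) (proof)] -/
theorem skPos_of_isRowSum {Lam Mu : Nat.Partition c} {lam mu : Nat.Partition a}
    {lam' mu' : Nat.Partition b} (hL : IsRowSum Lam lam lam') (hM : IsRowSum Mu mu mu')
    (h : SkPos lam mu) (h' : SkPos lam' mu') : SkPos Lam Mu := by
  obtain rfl : c = a + b := hL.eq_add
  obtain ⟨N, h1, h2, h3, h4, h5, h6⟩ := exists_parts_card_le₆ Lam Mu lam mu lam' mu'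
  rw [skPos_iff_exists lam mu h3 h4] at h
  rw [skPos_iff_exists lam' mu' h5 h6] at h'
  rw [skPos_iff_exists Lam Mu h1 h2, hL.ofPartition_eq N, hM.ofPartition_eq N]
  obtain ⟨M, hMm, hM0, hMi, hMs⟩ := h
  obtain ⟨M', hMm', hM0', hMi', hMs'⟩ := h'
  obtain ⟨P, hP, hP0, hPi, hPs⟩ := exists_twisted_invariant_mul (ε := 1) (ε' := 1)
    ⟨M, hMm, hM0, hMi, fun t => by rw [hMs t, one_mul]⟩
    ⟨M', hMm', hM0', hMi', fun t => by rw [hMs' t, one_mul]⟩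
  exact ⟨P, hP, hP0, hPi, fun t => by rw [hPs t, one_mul, one_mul]⟩

/-- **Skew times skew is symmetric**: `ak(λ, μ) > 0` and `ak(λ', μ') > 0` imply
`sk(λ + λ', μ + μ') > 0` (sharpening GIP Prop. 15(2): "if `f` and `g` are both
`𝔖₂`-skew-invariant, then `fg` is also `𝔖₂`-invariant"). [cite: GesmundoIkenmeyerPanova2017, Prop. 15(2) (proof)] -/
theorem skPos_of_isRowSum_of_akPos {Lam Mu : Nat.Partition c} {lam mu : Nat.Partition a}
    {lam' mu' : Nat.Partition b} (hL : IsRowSum Lam lam lam') (hM : IsRowSum Mu mu mu')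
    (h : AkPos lam mu) (h' : AkPos lam' mu') : SkPos Lam Mu := by
  obtain rfl : c = a + b := hL.eq_add
  obtain ⟨N, h1, h2, h3, h4, h5, h6⟩ := exists_parts_card_le₆ Lam Mu lam mu lam' mu'
  rw [akPos_iff_exists lam mu h3 h4] at h
  rw [akPos_iff_exists lam' mu' h5 h6] at h'
  rw [skPos_iff_exists Lam Mu h1 h2, hL.ofPartition_eq N, hM.ofPartition_eq N]
  obtain ⟨M, hMm, hM0, hMi, hMs⟩ := h
  obtain ⟨M', hMm', hM0', hMi', hMs'⟩ := h'
  obtain ⟨P, hP, hP0, hPi, hPs⟩ := exists_twisted_invariant_mul (ε := -1) (ε' := -1)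
    ⟨M, hMm, hM0, hMi, fun t => by rw [hMs t, neg_one_mul]⟩
    ⟨M', hMm', hM0', hMi', fun t => by rw [hMs' t, neg_one_mul]⟩
  exact ⟨P, hP, hP0, hPi, fun t => by rw [hPs t]; ring⟩

/-- **Symmetric times skew is skew**: `sk(λ, μ) > 0` and `ak(λ', μ') > 0` imply
`ak(λ + λ', μ + μ') > 0` (sharpening GIP Prop. 15(3)). [cite: GesmundoIkenmeyerPanova2017, Prop. 15(3) (proof)] -/
theorem akPos_of_isRowSum {Lam Mu : Nat.Partition c} {lam mu : Nat.Partition a}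
    {lam' mu' : Nat.Partition b} (hL : IsRowSum Lam lam lam') (hM : IsRowSum Mu mu mu')
    (h : SkPos lam mu) (h' : AkPos lam' mu') : AkPos Lam Mu := by
  obtain rfl : c = a + b := hL.eq_add
  obtain ⟨N, h1, h2, h3, h4, h5, h6⟩ := exists_parts_card_le₆ Lam Mu lam mu lam' mu'
  rw [skPos_iff_exists lam mu h3 h4] at h
  rw [akPos_iff_exists lam' mu' h5 h6] at h'
  rw [akPos_iff_exists Lam Mu h1 h2, hL.ofPartition_eq N, hM.ofPartition_eq N]
  obtain ⟨M, hMm, hM0, hMi, hMs⟩ := h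
  obtain ⟨M', hMm', hM0', hMi', hMs'⟩ := h'
  obtain ⟨P, hP, hP0, hPi, hPs⟩ := exists_twisted_invariant_mul (ε := 1) (ε' := -1)
    ⟨M, hMm, hM0, hMi, fun t => by rw [hMs t, one_mul]⟩
    ⟨M', hMm', hM0', hMi', fun t => by rw [hMs' t, neg_one_mul]⟩
  exact ⟨P, hP, hP0, hPi, fun t => by rw [hPs t]; ring⟩

end Semigroup

/-! ### 6. GIP Prop. 15 (semigroup properties of `sm`, `am`) discharged -/

section Prop15

variable {m c a b : ℕ}

/-- **GIP Prop. 15(1)**: "If `sm(λ,n) > 0` and `sm(ν,n) > 0`, then `sm(λ+ν, n) > 0`" (positivity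
form): witnesses `μ, μ'` with at most `n` rows and `sk(λ, μ), sk(ν, μ') > 0` give the witness
`μ + μ'` (at most `n` rows, `card_parts_rowAdd_le`) with `sk(λ + ν, μ + μ') > 0`.
[cite: GesmundoIkenmeyerPanova2017, Prop. 15(1)] -/
theorem smPos_of_isRowSum {Lam : Nat.Partition c} {lam : Nat.Partition a} {lam' : Nat.Partition b}
    (hL : IsRowSum Lam lam lam') (h : SmPos m lam) (h' : SmPos m lam') : SmPos m Lam := by
  obtain rfl : c = a + b := hL.eq_add
  obtain ⟨α, hα, hs⟩ := h
  obtain ⟨β, hβ, hs'⟩ := h'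
  exact ⟨α.rowAdd β, (card_parts_rowAdd_le α β).trans (max_le hα hβ),
    skPos_of_isRowSum hL (fun r => getD_sortedParts_rowAdd α β r) hs hs'⟩

/-- **GIP Prop. 15(2)**: "If `am(λ,n) > 0` and `am(ν,n) > 0`, then `sm(λ+ν,n) > 0`" (positivity
form). [cite: GesmundoIkenmeyerPanova2017, Prop. 15(2)] -/
theorem smPos_of_isRowSum_of_amPos {Lam : Nat.Partition c} {lam : Nat.Partition a}
    {lam' : Nat.Partition b} (hL : IsRowSum Lam lam lam') (h : AmPos m lam) (h' : AmPos m lam') :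
    SmPos m Lam := by
  obtain rfl : c = a + b := hL.eq_add
  obtain ⟨α, hα, hs⟩ := h
  obtain ⟨β, hβ, hs'⟩ := h'
  exact ⟨α.rowAdd β, (card_parts_rowAdd_le α β).trans (max_le hα hβ),
    skPos_of_isRowSum_of_akPos hL (fun r => getD_sortedParts_rowAdd α β r) hs hs'⟩

/-- **GIP Prop. 15(3)**: "If `sm(λ,n) > 0` and `am(ν,n) > 0`, then `am(λ+ν,n) > 0`" (positivity
form). [cite: GesmundoIkenmeyerPanova2017, Prop. 15(3)] -/
theorem amPos_of_isRowSum {Lam : Nat.Partition c} {lam : Nat.Partition a} {lam' : Nat.Partition b}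
    (hL : IsRowSum Lam lam lam') (h : SmPos m lam) (h' : AmPos m lam') : AmPos m Lam := by
  obtain rfl : c = a + b := hL.eq_add
  obtain ⟨α, hα, hs⟩ := h
  obtain ⟨β, hβ, hs'⟩ := h'
  exact ⟨α.rowAdd β, (card_parts_rowAdd_le α β).trans (max_le hα hβ),
    akPos_of_isRowSum hL (fun r => getD_sortedParts_rowAdd α β r) hs hs'⟩

/-- **GIP Prop. 15 (semigroup properties), positivity form — DISCHARGED.** The named fact
`GIP2017_prop15` of `GCTMatrixPoweringColumns.lean` ("(1) If `sm(λ,n) > 0` and `sm(ν,n) > 0`,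
then `sm(λ+ν, n) ≥ max(sm(λ,n), sm(ν,n))`. (2) If `am(λ,n) > 0` and `am(ν,n) > 0`, then
`sm(λ+ν,n) ≥ max(am(λ,n), am(ν,n))`. (3) If `sm(λ,n) > 0` and `am(ν,n) > 0`, then
`am(λ+ν,n) ≥ max(sm(λ,n), am(ν,n))`", vendored as the positivity conclusions) holds: proved by
GIP's own argument — multiply a symmetric/skew `𝔖`-invariant highest-weight tensor for `λ` with one
for `ν` — run in the word model of the tree (`HW_λ ⊗ HW_μ ⊗ HW_μ` inside functions on triples of
words, `KroneckerSemigroup.lean`) instead of `Sym^d(V ⊗ V^* ⊗ V)^H`, the identification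
`2·D!·sk(λ, μ) = skCharSum λ μ` being the invariant-dimension formula for the `𝔖_D × ℤˣ`-action
twisted by the switch of the two copies of `HW_μ` (`card_mul_finrank_invariants_twistedRep`).
[cite: GesmundoIkenmeyerPanova2017, Prop. 15] -/
theorem GIP2017_prop15_holds : GIP2017_prop15 := by
  intro n _ c a b lam mu nu hrs
  exact ⟨fun h h' => smPos_of_isRowSum hrs h h', fun h h' => smPos_of_isRowSum_of_amPos hrs h h',
    fun h h' => amPos_of_isRowSum hrs h h'⟩

end Prop15

/-! ### 7. `g = sk + ak` (GIP (3.1)) and the doubling `g(λ, μ, μ') > 0 ⇒ sk(2λ, μ + μ') > 0` -/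

section Kronecker

variable {N n a : ℕ}

/-- **GIP (3.1) at the level of character sums**: `skCharSum λ μ + akCharSum λ μ = 2·n!·g(λ, μ, μ)`
(`Σ_σ χ^λ χ^μ χ^μ = n!·g`, the tree's `kroneckerCoeff_eq_sum_spechtCharacter_holds`).
[cite: GesmundoIkenmeyerPanova2017, §3 ((3.1) g(λ,μ,μ) = sk(λ,μ) + ak(λ,μ))] -/
theorem skCharSum_add_akCharSum_eq (lam mu : Nat.Partition n) :
    skCharSum lam mu + akCharSum lam mu =
      2 * ((n.factorial * kroneckerCoeff ℂ lam mu mu : ℕ) : ℂ) := by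
  rw [skCharSum_add_akCharSum, kroneckerCoeff_eq_sum_spechtCharacter_holds ℂ lam mu mu]
  congr 1
  refine Finset.sum_congr rfl fun σ _ => ?_
  ring

/-- **GIP (3.1): `g(λ, μ, μ) = sk(λ, μ) + ak(λ, μ)`** with `sk`, `ak` realised as the dimensions of
the symmetric and skew `𝔖_n`-invariants of `HW_λ ⊗ HW_μ ⊗ HW_μ` ("Since `S²[μ] ⊕ Λ²[μ] = [μ] ⊗ [μ]`,
we trivially have `g(λ,μ,μ) = sk(λ,μ) + ak(λ,μ)`"). [cite: GesmundoIkenmeyerPanova2017, §3 ((3.1))] -/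
theorem kroneckerCoeff_eq_finrank_add_finrank (lam mu : Nat.Partition n) (hl : lam.parts.card ≤ N)
    (hm : mu.parts.card ≤ N) :
    kroneckerCoeff ℂ lam mu mu =
      Module.finrank ℂ (twistedRep ℂ N n (Weight.ofPartition N lam) (Weight.ofPartition N mu)
          1 (one_mul 1)).invariants +
        Module.finrank ℂ (twistedRep ℂ N n (Weight.ofPartition N lam) (Weight.ofPartition N mu)
          (-1) (by norm_num)).invariants := by
  have h := skCharSum_add_akCharSum_eq lam mu
  rw [skCharSum_eq_card_mul_finrank lam mu hl hm, akCharSum_eq_card_mul_finrank lam mu hl hm,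
    ← mul_add] at h
  have h2 : ((2 * n.factorial : ℕ) : ℂ) * (kroneckerCoeff ℂ lam mu mu : ℂ) =
      ((2 * n.factorial : ℕ) : ℂ) * ((Module.finrank ℂ (twistedRep ℂ N n (Weight.ofPartition N lam)
        (Weight.ofPartition N mu) 1 (one_mul 1)).invariants : ℂ) +
        (Module.finrank ℂ (twistedRep ℂ N n (Weight.ofPartition N lam) (Weight.ofPartition N mu)
          (-1) (by norm_num)).invariants : ℂ)) := by
    rw [h]
    push_cast
    ring
  have hne : ((2 * n.factorial : ℕ) : ℂ) ≠ 0 := by exact_mod_cast (by positivity : 2 * n.factorial ≠ 0)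
  exact_mod_cast mul_left_cancel₀ hne h2

/-- **A positive Kronecker coefficient `g(λ, μ, μ) > 0` is symmetric or skew**: `sk(λ, μ) > 0`
or `ak(λ, μ) > 0` (GIP (3.1); this is how Prop. 19 is derived from Cor. 38).
[cite: GesmundoIkenmeyerPanova2017, §3 ((3.1)) and Prop. 19 (proof)] -/
theorem skPos_or_akPos_of_kroneckerCoeff_pos (lam mu : Nat.Partition n)
    (h : 0 < kroneckerCoeff ℂ lam mu mu) : SkPos lam mu ∨ AkPos lam mu := by
  by_contra hcon
  rw [not_or, SkPos, AkPos, not_ne_iff, not_ne_iff] at hcon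
  have h1 := skCharSum_add_akCharSum_eq lam mu
  rw [hcon.1, hcon.2, add_zero] at h1
  have hpos : (2 : ℂ) * ((n.factorial * kroneckerCoeff ℂ lam mu mu : ℕ) : ℂ) ≠ 0 := by
    refine mul_ne_zero two_ne_zero ?_
    exact_mod_cast (Nat.mul_pos (Nat.factorial_pos n) h).ne'
  exact hpos h1.symm

/-- `sk(λ, μ) > 0 ⇒ g(λ, μ, μ) > 0`. [cite: GesmundoIkenmeyerPanova2017, §3 ((3.1))] -/
theorem kroneckerCoeff_pos_of_skPos {lam mu : Nat.Partition n} (h : SkPos lam mu) :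
    0 < kroneckerCoeff ℂ lam mu mu := by
  obtain ⟨N, hl, hm, -, -, -, -⟩ := exists_parts_card_le₆ lam mu lam lam lam lam
  rw [SkPos, skCharSum_eq_card_mul_finrank lam mu hl hm, mul_ne_zero_iff, Nat.cast_ne_zero,
    Nat.cast_ne_zero] at h
  rw [kroneckerCoeff_eq_finrank_add_finrank lam mu hl hm]
  omega

/-- `ak(λ, μ) > 0 ⇒ g(λ, μ, μ) > 0`. [cite: GesmundoIkenmeyerPanova2017, §3 ((3.1))] -/
theorem kroneckerCoeff_pos_of_akPos {lam mu : Nat.Partition n} (h : AkPos lam mu) :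
    0 < kroneckerCoeff ℂ lam mu mu := by
  obtain ⟨N, hl, hm, -, -, -, -⟩ := exists_parts_card_le₆ lam mu lam lam lam lam
  rw [AkPos, akCharSum_eq_card_mul_finrank lam mu hl hm, mul_ne_zero_iff, Nat.cast_ne_zero,
    Nat.cast_ne_zero] at h
  rw [kroneckerCoeff_eq_finrank_add_finrank lam mu hl hm]
  omega

variable {k : Type*} [Field k]

/-- Flipping the two blocks of a word of length `a + a` turns the first block into the second.
[folklore] -/
theorem take3_permute3_finAddFlip (t : Word3 N (a + a)) :
    take3 (permute3 (finAddFlip : Equiv.Perm (Fin (a + a))) t) = drop3 t := by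
  simp only [take3, drop3, permute3, Function.comp_apply, finAddFlip_apply_castAdd]

/-- Flipping the two blocks of a word of length `a + a` turns the second block into the first.
[folklore] -/
theorem drop3_permute3_finAddFlip (t : Word3 N (a + a)) :
    drop3 (permute3 (finAddFlip : Equiv.Perm (Fin (a + a))) t) = take3 t := by
  simp only [take3, drop3, permute3, Function.comp_apply, finAddFlip_apply_natAdd]

/-- **The symmetrised concatenation product of two tensors of the same length is commutative**
(the block flip is one of the permutations summed over). [folklore] -/
theorem sym3_concat3_comm (A B : Word3 N a → k) : sym3 (concat3 B A) = sym3 (concat3 A B) := by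
  funext t
  simp only [sym3]
  refine Fintype.sum_equiv (Equiv.mulRight (finAddFlip : Equiv.Perm (Fin (a + a)))) _ _
    fun τ => ?_
  rw [Equiv.coe_mulRight, permute3_mul, concat3, concat3, take3_permute3_finAddFlip,
    drop3_permute3_finAddFlip, mul_comm]

/-- **Doubling: `g(λ, μ, μ') > 0 ⇒ sk(λ + λ, μ + μ') > 0`.** An invariant `M ∈ HW_λ ⊗ HW_μ ⊗ HW_{μ'}`
and its switch `s M ∈ HW_λ ⊗ HW_{μ'} ⊗ HW_μ` have the SYMMETRIC nonzero invariant product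
`∑_τ τ · (M ⊙ s M)` of weights `(2λ, μ + μ', μ + μ')` (its switch is `∑_τ τ · (s M ⊙ M)`, the same
tensor by `sym3_concat3_comm`). For instance `g((1,1),(2),(1,1)) = 1` gives `sk((2,2),(3,1)) > 0`.
The argument is GIP's multiplication of highest-weight vectors (Prop. 15) applied to a tensor and
its switch. [cite: GesmundoIkenmeyerPanova2017, Prop. 15 (proof: multiplying highest weight vectors)] -/
theorem skPos_rowAdd_self_of_kroneckerCoeff_pos (lam mu mu' : Nat.Partition n)
    (h : 0 < kroneckerCoeff ℂ lam mu mu') : SkPos (lam.rowAdd lam) (mu.rowAdd mu') := by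
  obtain ⟨N, hl, hm, hm', -, -, -⟩ := exists_parts_card_le₆ lam mu mu' lam lam lam
  obtain ⟨M, hM, hM0, hMi⟩ := exists_invariant_of_kroneckerCoeff_pos (k := ℂ) hl hm hm' h
  have hL : (lam.rowAdd lam).parts.card ≤ N := (card_parts_rowAdd_le _ _).trans (max_le hl hl)
  have hMu : (mu.rowAdd mu').parts.card ≤ N := (card_parts_rowAdd_le _ _).trans (max_le hm hm')
  rw [skPos_iff_exists _ _ hL hMu, ofPartition_rowAdd, ofPartition_rowAdd]
  have hMsi : ∀ τ t, swapLin ℂ M (permute3 τ t) = swapLin ℂ M t := fun τ t => by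
    rw [swapLin_apply, swapLin_apply, ← permute3_swap3, hMi]
  have hMs0 : swapLin ℂ M ≠ 0 := fun h0 => hM0 (by rw [← swapLin_swapLin M, h0, map_zero])
  refine ⟨sym3 (concat3 M (swapLin ℂ M)), ?_, sym3_concat3_ne_zero hMi hMsi hM0 hMs0,
    fun τ t => sym3_permute3 _ τ t, fun t => ?_⟩
  · have := sym3_mem_tripleHw (concat3_mem_tripleHw hM (swapLin_mem_tripleHw hM))
    rwa [add_comm (Weight.ofPartition N mu') (Weight.ofPartition N mu)] at this
  · change swapLin ℂ (sym3 (concat3 M (swapLin ℂ M))) t = _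
    rw [swapLin_sym3, swapLin_concat3, swapLin_swapLin, sym3_concat3_comm]

end Kronecker

end Literature.Barriers.ValiantsHypothesis

end
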